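import Mathlib
import Literature.Dynamics.FixedPoints.StableManifoldTheorem
import HarnessLib

/-!
# The unstable set of a fixed point with a contracting direction is Lebesgue-null — proved
# (cone / Lipschitz-graph argument; Robinson, Ch. V §5.10; Katok–Hasselblatt §6.2)

Topic `Literature/Dynamics/FixedPoints`.  The sibling file `StableManifoldTheorem` vendors Robinson's
Stable Manifold Theorem (Ch. V Thm 10.1) as the NAMED FACT `Robinson1999_stableManifoldTheorem` and derives
from it `Robinson1999_stableManifoldTheorem.addHaar_unstableSet_eq_zero`: for a `C¹` map `f` of a
finite-dimensional space with a fixed point `p` at which `Df(p)` has a hyperbolic splitting `Es ⊕ Eu` with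
`Eu ≠ ⊤`, the set of points admitting a past history converging to `p` is Lebesgue-null.  THIS FILE PROVES
THAT COROLLARY UNCONDITIONALLY, without the manifold structure, by the first half of the Hadamard–Perron
argument only (the cone estimate):

* `IsHyperbolicSplitting.exists_pow_rates` — some iterate `N ≥ 1` of a hyperbolic splitting with `Eu ≠ ⊤`
  contracts `Es` by `½` and expands `Eu` by `2` in one step;
* `norm_projection_stable_le_of_pastHistories` — **THE CONE LEMMA**: if `F` is `C¹` and `DF(p)`
  contracts `Es` by `½` / expands `Eu` by `2` (invariant complementary subspaces), there is `r > 0` such that any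
  two `F`-past histories staying in `B(p, r)` have initial points whose difference lies in the unstable cone
  `‖π_s(q − q')‖ ≤ ‖π_u(q − q')‖` (otherwise the stable component would grow by `4/3` at each step into the past
  and leave the ball);
* `hausdorffMeasure_localUnstableSet_eq_zero` — hence the local unstable set (points with a past history inside
  `B(p, r)`) is the image of a subset of the proper subspace `Eu` under a `2`-Lipschitz map, so it is null for the
  `finrank`-dimensional Hausdorff measure (an additive Haar measure), hence for every additive Haar measure;
* **`addHaar_unstableSet_eq_zero`** — the global statement (`⋃_j f^j` of the local unstable set of `f^N`; `C¹`
  images of null sets are null): SAME CONCLUSION AND HYPOTHESES as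
  `Robinson1999_stableManifoldTheorem.addHaar_unstableSet_eq_zero` MINUS THE FACT;
* **`addHaar_setOf_tendsto_atBot_eq_zero`** — the flow form (time-one map), unconditional twin of
  `Robinson1999_stableManifoldTheorem.addHaar_setOf_tendsto_atBot_eq_zero`.

Consumer: the Navier–Stokes §B crux idea *hyperbolic-stagnation exclusion* (crux `PowerGaugeEulerLiouville`, item
stmt-NavierStokesRegularity-19832), whose step (M) used the fact only through this corollary — it becomes
unconditional.

## References

* C. Robinson, *Dynamical Systems*, 2nd ed. (1999), Ch. V §5.10, Thm 10.1 and its proof §5.10.1 (cones,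
  Lipschitz graphs), §5.10.3 (flows). [Robinson1999]
* J. K. Hale, L. T. Magalhães, W. M. Oliva, *Dynamics in Infinite Dimensions* (2002), §6.1, Def. 7.2.1.
  [HaleMagalhaesOliva2002]
-/

noncomputable section

open Filter Set Function Topology MeasureTheory Metric

namespace Literature.Dynamics.FixedPoints

universe u

variable {E : Type u} [NormedAddCommGroup E] [NormedSpace ℝ E] [FiniteDimensional ℝ E]

/-! ### Iterates of a hyperbolic splitting: one-step rates -/

omit [FiniteDimensional ℝ E] in
/-- Powers of `L` preserve the stable subspace. [cite: HaleMagalhaesOliva2002, Def. 7.2.1] -/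
theorem IsHyperbolicSplitting.pow_mapsTo_stable {L : E →L[ℝ] E} {Es Eu : Submodule ℝ E}
    (hL : IsHyperbolicSplitting L Es Eu) (n : ℕ) : ∀ x ∈ Es, (L ^ n) x ∈ Es := by
  induction n with
  | zero => intro x hx; simpa using hx
  | succ n ih =>
      intro x hx
      rw [pow_succ' L n, mul_apply_eq_comp]
      exact hL.mapsTo_stable _ (ih x hx)

omit [FiniteDimensional ℝ E] in
/-- Powers of `L` preserve the unstable subspace. [cite: HaleMagalhaesOliva2002, Def. 7.2.1] -/
theorem IsHyperbolicSplitting.pow_mapsTo_unstable {L : E →L[ℝ] E} {Es Eu : Submodule ℝ E}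
    (hL : IsHyperbolicSplitting L Es Eu) (n : ℕ) : ∀ x ∈ Eu, (L ^ n) x ∈ Eu := by
  induction n with
  | zero => intro x hx; simpa using hx
  | succ n ih =>
      intro x hx
      rw [pow_succ' L n, mul_apply_eq_comp]
      exact hL.mapsTo_unstable _ (ih x hx)

omit [FiniteDimensional ℝ E] in
/-- **One-step rates for an iterate.**  If `L` has a hyperbolic splitting `Es ⊕ Eu` with `Eu ≠ ⊤`, some
iterate `L^N`, `N ≥ 1`, contracts `Es` by the factor `½` and expands `Eu` by the factor `2`.
[cite: HaleMagalhaesOliva2002, Def. 7.2.1] -/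
theorem IsHyperbolicSplitting.exists_pow_rates {L : E →L[ℝ] E} {Es Eu : Submodule ℝ E}
    (hL : IsHyperbolicSplitting L Es Eu) (hEu : Eu ≠ ⊤) :
    ∃ N : ℕ, 1 ≤ N ∧ (∀ x ∈ Es, ‖(L ^ N) x‖ ≤ 2⁻¹ * ‖x‖) ∧ (∀ x ∈ Eu, 2 * ‖x‖ ≤ ‖(L ^ N) x‖) := by
  obtain ⟨n, hn⟩ := hL.eventually_contracting
  obtain ⟨m, hm⟩ := hL.eventually_expanding
  -- `n ≥ 1`, for otherwise `Es = ⊥` and `Eu = ⊤`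
  have hn1 : 1 ≤ n := by
    by_contra h0
    push Not at h0
    have hn0 : n = 0 := by omega
    subst hn0
    have hEs : Es = ⊥ := by
      rw [Submodule.eq_bot_iff]
      intro x hx
      have h := hn x hx
      rw [pow_zero, one_apply_eq_self] at h
      have : ‖x‖ = 0 := by nlinarith [norm_nonneg x]
      exact norm_eq_zero.1 this
    exact hEu (eq_top_of_isCompl_bot (hEs ▸ hL.isCompl.symm))
  -- iterated rates
  have hcon : ∀ k : ℕ, ∀ x ∈ Es, ‖((L ^ n) ^ k) x‖ ≤ (2⁻¹) ^ k * ‖x‖ := by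
    intro k
    induction k with
    | zero => intro x hx; simp
    | succ k ih =>
        intro x hx
        rw [pow_succ' (L ^ n) k, mul_apply_eq_comp]
        have hmem : ((L ^ n) ^ k) x ∈ Es := by
          rw [← pow_mul]; exact hL.pow_mapsTo_stable _ x hx
        calc ‖(L ^ n) (((L ^ n) ^ k) x)‖ ≤ 2⁻¹ * ‖((L ^ n) ^ k) x‖ := hn _ hmem
          _ ≤ 2⁻¹ * ((2⁻¹) ^ k * ‖x‖) := mul_le_mul_of_nonneg_left (ih x hx) (by norm_num)
          _ = (2⁻¹) ^ (k + 1) * ‖x‖ := by ring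
  have hexp : ∀ k : ℕ, ∀ x ∈ Eu, 2 ^ k * ‖x‖ ≤ ‖((L ^ m) ^ k) x‖ := by
    intro k
    induction k with
    | zero => intro x hx; simp
    | succ k ih =>
        intro x hx
        rw [pow_succ' (L ^ m) k, mul_apply_eq_comp]
        have hmem : ((L ^ m) ^ k) x ∈ Eu := by
          rw [← pow_mul]; exact hL.pow_mapsTo_unstable _ x hx
        calc (2 : ℝ) ^ (k + 1) * ‖x‖ = 2 * (2 ^ k * ‖x‖) := by ring
          _ ≤ 2 * ‖((L ^ m) ^ k) x‖ := mul_le_mul_of_nonneg_left (ih x hx) (by norm_num)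
          _ ≤ ‖(L ^ m) (((L ^ m) ^ k) x)‖ := hm _ hmem
  refine ⟨n * max m 1, Nat.one_le_iff_ne_zero.2 (Nat.mul_ne_zero (by omega) (by omega)), ?_, ?_⟩
  · intro x hx
    have h := hcon (max m 1) x hx
    rw [← pow_mul] at h
    refine h.trans (mul_le_mul_of_nonneg_right ?_ (norm_nonneg x))
    calc ((2 : ℝ)⁻¹) ^ (max m 1) ≤ (2⁻¹) ^ 1 :=
          pow_le_pow_of_le_one (by norm_num) (by norm_num) (le_max_right _ _)
      _ = 2⁻¹ := pow_one _
  · intro x hx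
    rcases Nat.eq_zero_or_pos m with hm0 | hmpos
    · -- `m = 0` forces `Eu = ⊥`
      subst hm0
      have hx0 : x = 0 := by
        have h := hm x hx
        rw [pow_zero, one_apply_eq_self] at h
        have : ‖x‖ = 0 := by nlinarith [norm_nonneg x]
        exact norm_eq_zero.1 this
      simp [hx0]
    · have hmax : max m 1 = m := max_eq_left hmpos
      rw [hmax]
      have h := hexp n x hx
      rw [← pow_mul, mul_comm m n] at h
      refine le_trans (mul_le_mul_of_nonneg_right ?_ (norm_nonneg x)) h
      calc (2 : ℝ) = 2 ^ 1 := (pow_one _).symm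
        _ ≤ 2 ^ n := pow_le_pow_right₀ (by norm_num) hn1

/-! ### The cone lemma -/

section Cone

variable {F : E → E} {p : E} {Es Eu : Submodule ℝ E}

omit [FiniteDimensional ℝ E] in
/-- The projections commute with a map preserving both summands: `π_s(Lw) = L(π_s w)`. [folklore] -/
private theorem projection_map_of_invariant (hcompl : IsCompl Es Eu) (L : E →L[ℝ] E)
    (hs : ∀ x ∈ Es, L x ∈ Es) (hu : ∀ x ∈ Eu, L x ∈ Eu) (w : E) :
    Es.projection Eu hcompl (L w) = L (Es.projection Eu hcompl w) := by
  conv_lhs => rw [← Submodule.projection_add_projection_eq_self hcompl w]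
  rw [map_add, map_add, Submodule.projection_apply_of_mem_left hcompl (hs _ (Submodule.projection_apply_mem hcompl w)),
    Submodule.projection_apply_of_mem_right hcompl (hu _ (Submodule.projection_apply_mem hcompl.symm w)), add_zero]

/-- A past history of `F` recovers its initial point: `F^[i] (q_{j+i}) = q_j`. [folklore] -/
private theorem iterate_apply_pastHistory {X : Type*} {F : X → X} {qs : ℕ → X}
    (hqs : ∀ j, F (qs (j + 1)) = qs j) (i j : ℕ) : F^[i] (qs (j + i)) = qs j := by
  induction i generalizing j with
  | zero => rfl
  | succ i ih =>
      rw [Function.iterate_succ_apply, show j + (i + 1) = (j + i) + 1 by ring, hqs (j + i)]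
      exact ih j

/-- **THE CONE LEMMA** (Robinson, Ch. V §5.10.1; Katok–Hasselblatt §6.2).  Let `F` be `C¹` and let `p` be a point at
which `DF(p)` preserves the complementary subspaces `Es`, `Eu`, contracting `Es` by `½` and expanding `Eu` by `2`.
Then there is `r > 0` such that for any two past histories `(q_k)`, `(q'_k)` of `F` (`F q_{k+1} = q_k`) contained
in `B(p, r)`, the difference of the initial points lies in the unstable cone:
`‖π_s(q_0 − q'_0)‖ ≤ ‖π_u(q_0 − q'_0)‖`.  (If not, the stable components `s_k = ‖π_s(q_k − q'_k)‖` would satisfy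
`s_{k+1} ≥ (4/3) s_k`, contradicting boundedness.) [cite: Robinson1999, Ch. V §5.10.1 (proof of Thm 10.1)] -/
theorem norm_projection_stable_le_of_pastHistories (hF : ContDiff ℝ 1 F)
    (hcompl : IsCompl Es Eu) (hs : ∀ x ∈ Es, fderiv ℝ F p x ∈ Es) (hu : ∀ x ∈ Eu, fderiv ℝ F p x ∈ Eu)
    (hcon : ∀ x ∈ Es, ‖fderiv ℝ F p x‖ ≤ 2⁻¹ * ‖x‖) (hexp : ∀ x ∈ Eu, 2 * ‖x‖ ≤ ‖fderiv ℝ F p x‖) :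
    ∃ r : ℝ, 0 < r ∧ ∀ qs qs' : ℕ → E, (∀ k, F (qs (k + 1)) = qs k) → (∀ k, F (qs' (k + 1)) = qs' k) →
      (∀ k, qs k ∈ ball p r) → (∀ k, qs' k ∈ ball p r) →
        ‖Es.projection Eu hcompl (qs 0 - qs' 0)‖ ≤ ‖Eu.projection Es hcompl.symm (qs 0 - qs' 0)‖ := by
  set L : E →L[ℝ] E := fderiv ℝ F p with hLdef
  set Ps : E →L[ℝ] E := LinearMap.toContinuousLinearMap (Es.projection Eu hcompl) with hPs
  set Pu : E →L[ℝ] E := LinearMap.toContinuousLinearMap (Eu.projection Es hcompl.symm) with hPu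
  have hPs_apply : ∀ w, Ps w = Es.projection Eu hcompl w := fun w => rfl
  have hPu_apply : ∀ w, Pu w = Eu.projection Es hcompl.symm w := fun w => rfl
  set P : ℝ := max ‖Ps‖ ‖Pu‖ + 1 with hPdef
  have hP0 : 0 < P := by rw [hPdef]; positivity
  have hPs_le : ∀ w, ‖Ps w‖ ≤ P * ‖w‖ := fun w =>
    (Ps.le_opNorm w).trans (mul_le_mul_of_nonneg_right (by rw [hPdef]; linarith [le_max_left ‖Ps‖ ‖Pu‖])
      (norm_nonneg _))
  have hPu_le : ∀ w, ‖Pu w‖ ≤ P * ‖w‖ := fun w =>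
    (Pu.le_opNorm w).trans (mul_le_mul_of_nonneg_right (by rw [hPdef]; linarith [le_max_right ‖Ps‖ ‖Pu‖])
      (norm_nonneg _))
  -- `ε` with `P ε = 1/8`
  set ε : ℝ := 1 / (8 * P) with hεdef
  have hε : 0 < ε := by rw [hεdef]; positivity
  have hPε : P * ε = 1 / 8 := by rw [hεdef]; field_simp
  -- radius: `‖DF(q) − L‖ ≤ ε` on `B(p, r)`
  have hDFc : Continuous (fderiv ℝ F) := hF.continuous_fderiv one_ne_zero
  obtain ⟨r, hr, hrε⟩ : ∃ r > 0, ∀ q, dist q p < r → dist (fderiv ℝ F q) (fderiv ℝ F p) < ε :=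
    Metric.continuousAt_iff.1 hDFc.continuousAt ε hε
  refine ⟨r, hr, fun qs qs' hqs hqs' hB hB' => ?_⟩
  -- the remainder `g = F − L` is `ε`-Lipschitz on the ball
  have hFd : Differentiable ℝ F := hF.differentiable one_ne_zero
  have hg : ∀ x ∈ ball p r, ∀ y ∈ ball p r, ‖(F y - L y) - (F x - L x)‖ ≤ ε * ‖y - x‖ := by
    intro x hx y hy
    have h := (convex_ball p r).norm_image_sub_le_of_norm_fderiv_le (f := fun z => F z - L z) (C := ε)
      (fun z _ => (hFd z).sub (L.differentiableAt)) (fun z hz => ?_) hx hy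
    · exact h
    · rw [fderiv_fun_sub (hFd z) L.differentiableAt, ContinuousLinearMap.fderiv]
      rw [← dist_eq_norm]
      exact (hrε z (mem_ball.1 hz)).le
  -- notation for the two histories
  set w : ℕ → E := fun k => qs k - qs' k with hw
  set s : ℕ → ℝ := fun k => ‖Ps (w k)‖ with hsdef
  set u : ℕ → ℝ := fun k => ‖Pu (w k)‖ with hudef
  have hwsum : ∀ k, ‖w k‖ ≤ s k + u k := by
    intro k
    have e : w k = Ps (w k) + Pu (w k) := by
      rw [hPs_apply, hPu_apply, Submodule.projection_add_projection_eq_self]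
    calc ‖w k‖ = ‖Ps (w k) + Pu (w k)‖ := by rw [← e]
      _ ≤ s k + u k := norm_add_le _ _
  -- the one-step relation `w k = L (w (k+1)) + Δ`, `‖Δ‖ ≤ ε ‖w (k+1)‖`
  have hstep : ∀ k, ‖w k - L (w (k + 1))‖ ≤ ε * ‖w (k + 1)‖ := by
    intro k
    have h := hg (qs' (k + 1)) (hB' (k + 1)) (qs (k + 1)) (hB (k + 1))
    have e : w k - L (w (k + 1)) = (F (qs (k + 1)) - L (qs (k + 1))) - (F (qs' (k + 1)) - L (qs' (k + 1))) := by
      simp only [hw, map_sub, hqs k, hqs' k]; abel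
    rw [e]
    exact h
  have hcomm_s : ∀ v, Ps (L v) = L (Ps v) := fun v => by
    rw [hPs_apply, hPs_apply]; exact projection_map_of_invariant hcompl L hs hu v
  have hcomm_u : ∀ v, Pu (L v) = L (Pu v) := fun v => by
    rw [hPu_apply, hPu_apply]; exact projection_map_of_invariant hcompl.symm L hu hs v
  -- (E1) `s k ≤ ½ s (k+1) + P ε ‖w (k+1)‖`
  have hE1 : ∀ k, s k ≤ 2⁻¹ * s (k + 1) + P * ε * ‖w (k + 1)‖ := by
    intro k
    have e : Ps (w k) = L (Ps (w (k + 1))) + Ps (w k - L (w (k + 1))) := by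
      rw [map_sub Ps (w k) (L (w (k + 1))), hcomm_s]; abel
    have h1 : ‖L (Ps (w (k + 1)))‖ ≤ 2⁻¹ * ‖Ps (w (k + 1))‖ :=
      hcon _ (by rw [hPs_apply]; exact Submodule.projection_apply_mem hcompl _)
    have h2 : ‖Ps (w k - L (w (k + 1)))‖ ≤ P * ε * ‖w (k + 1)‖ := by
      calc ‖Ps (w k - L (w (k + 1)))‖ ≤ P * ‖w k - L (w (k + 1))‖ := hPs_le _
        _ ≤ P * (ε * ‖w (k + 1)‖) := mul_le_mul_of_nonneg_left (hstep k) hP0.le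
        _ = P * ε * ‖w (k + 1)‖ := by ring
    calc s k = ‖Ps (w k)‖ := rfl
      _ = ‖L (Ps (w (k + 1))) + Ps (w k - L (w (k + 1)))‖ := by rw [← e]
      _ ≤ ‖L (Ps (w (k + 1)))‖ + ‖Ps (w k - L (w (k + 1)))‖ := norm_add_le _ _
      _ ≤ 2⁻¹ * s (k + 1) + P * ε * ‖w (k + 1)‖ := add_le_add h1 h2
  -- (E2) `2 u (k+1) − P ε ‖w (k+1)‖ ≤ u k`
  have hE2 : ∀ k, 2 * u (k + 1) - P * ε * ‖w (k + 1)‖ ≤ u k := by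
    intro k
    have e : L (Pu (w (k + 1))) = Pu (w k) - Pu (w k - L (w (k + 1))) := by
      rw [map_sub Pu (w k) (L (w (k + 1))), hcomm_u]; abel
    have h1 : 2 * ‖Pu (w (k + 1))‖ ≤ ‖L (Pu (w (k + 1)))‖ :=
      hexp _ (by rw [hPu_apply]; exact Submodule.projection_apply_mem hcompl.symm _)
    have h2 : ‖Pu (w k - L (w (k + 1)))‖ ≤ P * ε * ‖w (k + 1)‖ := by
      calc ‖Pu (w k - L (w (k + 1)))‖ ≤ P * ‖w k - L (w (k + 1))‖ := hPu_le _
        _ ≤ P * (ε * ‖w (k + 1)‖) := mul_le_mul_of_nonneg_left (hstep k) hP0.le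
        _ = P * ε * ‖w (k + 1)‖ := by ring
    have h3 : ‖L (Pu (w (k + 1)))‖ ≤ ‖Pu (w k)‖ + ‖Pu (w k - L (w (k + 1)))‖ := by
      rw [e]; exact norm_sub_le _ _
    calc 2 * u (k + 1) - P * ε * ‖w (k + 1)‖ ≤ ‖L (Pu (w (k + 1)))‖ - ‖Pu (w k - L (w (k + 1)))‖ := by
          have := h1; have := h2; simp only [hudef]; linarith
      _ ≤ u k := by simp only [hudef]; linarith
  -- the cone is backward invariant with growth `4/3` of the stable component
  by_contra hcone
  push Not at hcone
  have hcone0 : u 0 < s 0 := hcone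
  have hind : ∀ k, u k < s k ∧ (4 / 3 : ℝ) ^ k * s 0 ≤ s k := by
    intro k
    induction k with
    | zero => exact ⟨hcone0, by simp⟩
    | succ k ih =>
        obtain ⟨ihk, ihg⟩ := ih
        have hu0 : 0 ≤ u k := norm_nonneg _
        have hs1 : 0 ≤ s (k + 1) := norm_nonneg _
        have hu1 : 0 ≤ u (k + 1) := norm_nonneg _
        have e1 := hE1 k
        have e2 := hE2 k
        have ws := hwsum (k + 1)
        -- first: `u (k+1) < s (k+1)`
        have hlt : u (k + 1) < s (k + 1) := by
          by_contra hge
          push Not at hge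
          -- `‖w (k+1)‖ ≤ 2 u (k+1)`, so `u k ≥ (7/4) u (k+1)` and `s k ≤ (3/4) u (k+1)`
          have hw2 : ‖w (k + 1)‖ ≤ 2 * u (k + 1) := by linarith
          have h1 : s k ≤ 2⁻¹ * u (k + 1) + 1 / 8 * (2 * u (k + 1)) := by
            calc s k ≤ 2⁻¹ * s (k + 1) + P * ε * ‖w (k + 1)‖ := e1
              _ ≤ 2⁻¹ * u (k + 1) + P * ε * (2 * u (k + 1)) := by
                  rw [hPε]; nlinarith
              _ = 2⁻¹ * u (k + 1) + 1 / 8 * (2 * u (k + 1)) := by rw [hPε]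
          have h2 : 2 * u (k + 1) - 1 / 8 * (2 * u (k + 1)) ≤ u k := by
            calc 2 * u (k + 1) - 1 / 8 * (2 * u (k + 1)) ≤ 2 * u (k + 1) - P * ε * ‖w (k + 1)‖ := by
                  rw [hPε]; nlinarith
              _ ≤ u k := e2
          nlinarith
        refine ⟨hlt, ?_⟩
        -- then `‖w (k+1)‖ ≤ 2 s (k+1)` and `s k ≤ (3/4) s (k+1)`
        have hw2 : ‖w (k + 1)‖ ≤ 2 * s (k + 1) := by linarith
        have h1 : s k ≤ 3 / 4 * s (k + 1) := by
          calc s k ≤ 2⁻¹ * s (k + 1) + P * ε * ‖w (k + 1)‖ := e1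
            _ ≤ 2⁻¹ * s (k + 1) + P * ε * (2 * s (k + 1)) := by rw [hPε]; nlinarith
            _ = 3 / 4 * s (k + 1) := by rw [hPε]; ring
        calc (4 / 3 : ℝ) ^ (k + 1) * s 0 = 4 / 3 * ((4 / 3) ^ k * s 0) := by ring
          _ ≤ 4 / 3 * s k := mul_le_mul_of_nonneg_left ihg (by norm_num)
          _ ≤ s (k + 1) := by linarith
  -- but `s k ≤ P ‖w k‖ < 2 P r`
  have hbdd : ∀ k, s k ≤ P * (2 * r) := by
    intro k
    have h1 : ‖w k‖ ≤ 2 * r := by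
      have hq := mem_ball.1 (hB k)
      have hq' := mem_ball.1 (hB' k)
      rw [dist_eq_norm] at hq hq'
      calc ‖w k‖ = ‖(qs k - p) - (qs' k - p)‖ := by simp [hw]
        _ ≤ ‖qs k - p‖ + ‖qs' k - p‖ := norm_sub_le _ _
        _ ≤ 2 * r := by linarith
    exact (hPs_le _).trans (mul_le_mul_of_nonneg_left h1 hP0.le)
  have hs0 : 0 < s 0 := lt_of_le_of_lt (norm_nonneg _) hcone0
  have htend : Tendsto (fun k : ℕ => (4 / 3 : ℝ) ^ k * s 0) atTop atTop :=
    (tendsto_pow_atTop_atTop_of_one_lt (by norm_num)).atTop_mul_const hs0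
  obtain ⟨k, hk⟩ := (htend.eventually (eventually_gt_atTop (P * (2 * r)))).exists
  have := (hind k).2
  linarith [hbdd k]

/-! ### The local unstable set is a Lipschitz graph over `Eu`, hence null -/

variable [MeasurableSpace E] [BorelSpace E]

/-- **The local unstable set is null.**  Under the hypotheses of the cone lemma, with `Eu ≠ ⊤`, the set of points
admitting an `F`-past history inside the ball `B(p, r)` of the cone lemma is null for the `finrank`-dimensional
Hausdorff measure: it is the image of a subset of the proper subspace `Eu` under a `2`-Lipschitz map (the inverse
of `π_u` on it). [cite: Robinson1999, Ch. V §5.10.1 (W^u_loc is a Lipschitz graph)] -/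
theorem hausdorffMeasure_localUnstableSet_eq_zero (hF : ContDiff ℝ 1 F)
    (hcompl : IsCompl Es Eu) (hs : ∀ x ∈ Es, fderiv ℝ F p x ∈ Es) (hu : ∀ x ∈ Eu, fderiv ℝ F p x ∈ Eu)
    (hcon : ∀ x ∈ Es, ‖fderiv ℝ F p x‖ ≤ 2⁻¹ * ‖x‖) (hexp : ∀ x ∈ Eu, 2 * ‖x‖ ≤ ‖fderiv ℝ F p x‖)
    (hEu : Eu ≠ ⊤) :
    ∃ r : ℝ, 0 < r ∧ μH[Module.finrank ℝ E]
      {q : E | ∃ qs : ℕ → E, qs 0 = q ∧ (∀ k, F (qs (k + 1)) = qs k) ∧ ∀ k, qs k ∈ ball p r} = 0 := by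
  obtain ⟨r, hr, hcone⟩ := norm_projection_stable_le_of_pastHistories hF hcompl hs hu hcon hexp
  refine ⟨r, hr, ?_⟩
  set W : Set E := {q : E | ∃ qs : ℕ → E, qs 0 = q ∧ (∀ k, F (qs (k + 1)) = qs k) ∧ ∀ k, qs k ∈ ball p r}
    with hW
  set πu : E → E := fun x => Eu.projection Es hcompl.symm x with hπu
  -- on `W`, distances are controlled by the unstable components
  have hkey : ∀ q ∈ W, ∀ q' ∈ W, ‖q - q'‖ ≤ 2 * ‖πu q - πu q'‖ := by
    rintro q ⟨qs, rfl, hqs, hB⟩ q' ⟨qs', rfl, hqs', hB'⟩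
    have h := hcone qs qs' hqs hqs' hB hB'
    have e : qs 0 - qs' 0 = Es.projection Eu hcompl (qs 0 - qs' 0) + Eu.projection Es hcompl.symm (qs 0 - qs' 0) :=
      (Submodule.projection_add_projection_eq_self hcompl _).symm
    have hπ : πu (qs 0) - πu (qs' 0) = Eu.projection Es hcompl.symm (qs 0 - qs' 0) := by
      simp only [hπu, map_sub]
    rw [hπ]
    calc ‖qs 0 - qs' 0‖ = ‖Es.projection Eu hcompl (qs 0 - qs' 0) + Eu.projection Es hcompl.symm (qs 0 - qs' 0)‖ := by
          rw [← e]
      _ ≤ ‖Es.projection Eu hcompl (qs 0 - qs' 0)‖ + ‖Eu.projection Es hcompl.symm (qs 0 - qs' 0)‖ :=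
          norm_add_le _ _
      _ ≤ 2 * ‖Eu.projection Es hcompl.symm (qs 0 - qs' 0)‖ := by linarith
  -- the inverse of `πu` on `W` is `2`-Lipschitz and `W` is its image of `πu '' W ⊆ Eu`
  set g : E → E := Function.invFunOn πu W with hg
  have hgW : ∀ x ∈ πu '' W, g x ∈ W ∧ πu (g x) = x := fun x hx =>
    Function.invFunOn_pos (by obtain ⟨q, hq, rfl⟩ := hx; exact ⟨q, hq, rfl⟩)
  have hLip : LipschitzOnWith 2 g (πu '' W) := by
    refine LipschitzOnWith.of_dist_le_mul fun x hx y hy => ?_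
    obtain ⟨hgx, hx'⟩ := hgW x hx
    obtain ⟨hgy, hy'⟩ := hgW y hy
    rw [dist_eq_norm, dist_eq_norm]
    have h := hkey _ hgx _ hgy
    rw [hx', hy'] at h
    exact_mod_cast h
  have hWsub : W ⊆ g '' (πu '' W) := by
    intro q hq
    have hx : πu q ∈ πu '' W := mem_image_of_mem _ hq
    obtain ⟨hgx, hx'⟩ := hgW _ hx
    refine ⟨πu q, hx, ?_⟩
    have h := hkey _ hgx _ hq
    rw [hx', sub_self, norm_zero, mul_zero] at h
    have : g (πu q) - q = 0 := norm_le_zero_iff.1 h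
    exact sub_eq_zero.1 this
  -- `πu '' W ⊆ Eu`, a proper subspace: Hausdorff-null
  have hd : (0 : ℝ) ≤ (Module.finrank ℝ E : ℝ) := Nat.cast_nonneg _
  have hEu0 : μH[Module.finrank ℝ E] (Eu : Set E) = 0 := Measure.addHaar_submodule _ Eu hEu
  have hD0 : μH[Module.finrank ℝ E] (πu '' W) = 0 :=
    measure_mono_null (by rintro _ ⟨q, -, rfl⟩; exact Submodule.projection_apply_mem hcompl.symm q) hEu0
  have himg : μH[Module.finrank ℝ E] (g '' (πu '' W)) = 0 := by
    have h := hLip.hausdorffMeasure_image_le hd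
    rw [hD0, mul_zero] at h
    exact le_antisymm h bot_le
  exact measure_mono_null hWsub himg

end Cone

/-! ### The global statement -/

section Global

variable [MeasurableSpace E] [BorelSpace E]

omit [FiniteDimensional ℝ E] [MeasurableSpace E] [BorelSpace E] in
/-- `f^[n]` is `C¹` when `f` is. [folklore] -/
private theorem contDiff_iterate {f : E → E} (hf : ContDiff ℝ 1 f) (n : ℕ) : ContDiff ℝ 1 f^[n] := by
  induction n with
  | zero => exact contDiff_id
  | succ n ih => rw [Function.iterate_succ']; exact hf.comp ih

/-- **The unstable set of a hyperbolic fixed point with a proper unstable subspace is Lebesgue-null —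
unconditionally** (same statement as `Robinson1999_stableManifoldTheorem.addHaar_unstableSet_eq_zero`, without
the named fact).  Let `f : E → E` be `C¹` on the finite-dimensional space `E` with a fixed point `p` at which
`Df(p)` has a hyperbolic splitting `Es ⊕ Eu`, `Eu ≠ ⊤`.  Then the set of points `q` admitting a past history
`q₀ = q, f(q_{-j-1}) = q_{-j}` with `q_{-j} → p` has measure zero for every additive Haar measure: such a history,
sampled along the iterate `F = f^N` of the rate lemma, eventually stays in the ball of the cone lemma, so
`q ∈ f^j(W^u_loc(F))` for some `j`; `W^u_loc(F)` is Hausdorff-null (a Lipschitz graph over a proper subspace),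
additive Haar measures are absolutely continuous with respect to the Hausdorff measure, and `C¹` maps preserve
null sets. [cite: Robinson1999, Ch. V Thm 10.1 (and the global unstable manifold after it)] -/
theorem addHaar_unstableSet_eq_zero (μ : Measure E) [μ.IsAddHaarMeasure]
    {f : E → E} (hf : ContDiff ℝ 1 f) {p : E} (hp : f p = p) {Es Eu : Submodule ℝ E}
    (hL : IsHyperbolicSplitting (fderiv ℝ f p) Es Eu) (hEu : Eu ≠ ⊤) :
    μ {q | ∃ qs : ℕ → E, qs 0 = q ∧ (∀ j, f (qs (j + 1)) = qs j) ∧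
      Tendsto qs atTop (𝓝 p)} = 0 := by
  -- the iterate with one-step rates
  obtain ⟨N, hN1, hconN, hexpN⟩ := hL.exists_pow_rates hEu
  set F : E → E := f^[N] with hFdef
  have hF : ContDiff ℝ 1 F := contDiff_iterate hf N
  have hFp : F p = p := Function.iterate_fixed hp N
  have hDF : fderiv ℝ F p = fderiv ℝ f p ^ N :=
    ((hf.differentiable one_ne_zero p).hasFDerivAt.iterate hp N).fderiv
  have hs : ∀ x ∈ Es, fderiv ℝ F p x ∈ Es := by rw [hDF]; exact hL.pow_mapsTo_stable N
  have hu : ∀ x ∈ Eu, fderiv ℝ F p x ∈ Eu := by rw [hDF]; exact hL.pow_mapsTo_unstable N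
  have hcon : ∀ x ∈ Es, ‖fderiv ℝ F p x‖ ≤ 2⁻¹ * ‖x‖ := by rw [hDF]; exact hconN
  have hexp : ∀ x ∈ Eu, 2 * ‖x‖ ≤ ‖fderiv ℝ F p x‖ := by rw [hDF]; exact hexpN
  obtain ⟨r, hr, hW0⟩ := hausdorffMeasure_localUnstableSet_eq_zero (p := p) hF hL.isCompl hs hu hcon hexp hEu
  set W : Set E := {q : E | ∃ qs : ℕ → E, qs 0 = q ∧ (∀ k, F (qs (k + 1)) = qs k) ∧ ∀ k, qs k ∈ ball p r}
    with hW
  -- `μ ≪ μH[finrank]`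
  have hμW : μ W = 0 :=
    (Measure.absolutelyContinuous_isAddHaarMeasure μ (μH[Module.finrank ℝ E])) hW0
  have hNj : ∀ j : ℕ, μ (f^[j] '' W) = 0 := fun j =>
    addHaar_image_eq_zero_of_differentiableOn_of_addHaar_eq_zero μ
      ((hf.differentiable one_ne_zero).iterate j).differentiableOn hμW
  refine measure_mono_null (fun q hq => ?_) (measure_iUnion_null hNj)
  obtain ⟨qs, h0, hstep, hlim⟩ := hq
  -- the `F`-history `k ↦ qs (N k)` converges to `p`, hence eventually lies in the ball
  have hmono : StrictMono fun k : ℕ => N * k := fun a b hab => Nat.mul_lt_mul_of_pos_left hab (by omega)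
  have hlimN : Tendsto (fun k => qs (N * k)) atTop (𝓝 p) := hlim.comp hmono.tendsto_atTop
  obtain ⟨K, hK⟩ := eventually_atTop.1 (hlimN.eventually (ball_mem_nhds p hr))
  have hmem : qs (N * K) ∈ W := by
    refine ⟨fun i => qs (N * (K + i)), by simp, fun i => ?_, fun i => hK _ (Nat.le_add_right _ _)⟩
    show f^[N] (qs (N * (K + (i + 1)))) = qs (N * (K + i))
    rw [show N * (K + (i + 1)) = N * (K + i) + N by ring]
    exact iterate_apply_pastHistory hstep N (N * (K + i))
  refine mem_iUnion.2 ⟨N * K, ?_⟩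
  rw [← h0, ← iterate_apply_pastHistory hstep (N * K) 0, zero_add]
  exact mem_image_of_mem _ hmem

/-- **Flows: the set of points converging backward to an equilibrium whose time-one linearisation has a
hyperbolic splitting with a contracting direction is Lebesgue-null — unconditionally** (twin of
`Robinson1999_stableManifoldTheorem.addHaar_setOf_tendsto_atBot_eq_zero` without the named fact).
[cite: Robinson1999, Ch. V Thm 10.1 and §5.10.3] -/
theorem addHaar_setOf_tendsto_atBot_eq_zero (μ : Measure E) [μ.IsAddHaarMeasure]
    {Φ : ℝ → E → E} (hΦ0 : ∀ y, Φ 0 y = y) (hΦ : ∀ s t y, Φ (s + t) y = Φ s (Φ t y))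
    (h1 : ContDiff ℝ 1 (Φ 1)) {p : E} (hp : Φ 1 p = p) {Es Eu : Submodule ℝ E}
    (hL : IsHyperbolicSplitting (fderiv ℝ (Φ 1) p) Es Eu) (hEu : Eu ≠ ⊤) :
    μ {y | Tendsto (fun s => Φ s y) atBot (𝓝 p)} = 0 :=
  measure_mono_null (fun _ hy => exists_pastHistory_of_tendsto_atBot hΦ0 hΦ hy)
    (addHaar_unstableSet_eq_zero μ h1 hp hL hEu)

end Global

end Literature.Dynamics.FixedPoints

end
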